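import Mathlib
import HarnessLib
import Summits.ValiantsHypothesis.ValiantsHypothesis.Theses.MonotoneRestoration
import Summits.ValiantsHypothesis.ValiantsHypothesis.Theorems.MonotoneRestorationQP.Negative.UniformExponentFalse
import Summits.ValiantsHypothesis.ValiantsHypothesis.Theorems.MonotoneRestorationQP.Negative.LoadBearing
import Literature.Computability.AlgebraicComplexity.DawarWilsenach2025
import Literature.Computability.AlgebraicComplexity.SymmetricPowerChainCircuitRigid

/-!
# `MonotoneRestoration.MonotoneRestorationQP` (stmt-ValiantsHypothesis-15886) — negative side: orbit compression needs `VP`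

Route MonotoneRestoration, crux `MonotoneRestorationQP`, line Sketch v10 (the orbit cut), stub
Z11 `orbitCompression_false_without_VP`.  The cut's second lemma L2 (`stub_orbitCompression`)
says: a matrix-symmetric `VP` family over `ℂ` with square-symmetric circuits of
quasi-polynomial ORBIT size (Dawar–Wilsenach `ORB`, over all automorphisms) has
square-symmetric circuits of quasi-polynomial SIZE.  This file certifies that the `VP`
hypothesis is LOAD-BEARING: L2 with `IsVPFamily f` deleted is FALSE.

Witness: `f n = (Σ_ij x_ij)^(2^(2^n))`.  It is matrix-symmetric; the symmetric power chain
(`Literature/…/SymmetricPowerChainCircuit.lean`, `…Rigid.lean`: inputs, `0`, one invariant sum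
gate, then `2^n` squarings `level (k+1) = level k × copy k`) computes it with every internal
gate fixed by every automorphism, so its orbit size is `≤ max n² 1 ≤ 2^((log₂ n + 2)^2)`;
but ANY labelled circuit with `s` gates computes a polynomial of total degree `≤ s^s`
(`Negative.totalDegree_eval_le`), and `s ≤ 2^E`, `E = (log₂ n + c)^c`, gives
`s^s ≤ 2^(E 2^E) < 2^(2^(2E)) ≤ 2^(2^n) = deg f n` as soon as `2E < n`
(`Negative.polylog_pow_lt_linear`).  The witness has super-polynomial degree, so it is not a
`VP` family and L2 itself is untouched.  No facts, no definitions. [new]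
-/

noncomputable section

set_option linter.dupNamespace false

namespace Summit.ValiantsHypothesis.ValiantsHypothesis.Theorems

open Literature.Computability.AlgebraicComplexity MvPolynomial

/-- **Z11 — orbit compression is false without `VP`** (crux `MonotoneRestorationQP`, line Sketch
v10; registered stub `orbitCompression_false_without_VP`): it is NOT the case that every
matrix-symmetric family over `ℂ` with square-symmetric circuits of quasi-polynomial orbit size
has square-symmetric circuits of quasi-polynomial size.  Witness `(Σ_ij x_ij)^(2^(2^n))`: the
symmetric power chain has orbit size `≤ max n² 1` (`LabelledArithCircuit.exists_symmetric_powerChain`),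
while a circuit with `s ≤ 2^((log₂ n + c)^c)` gates has degree `≤ s^s < 2^(2^n)` for large `n`
(`Negative.totalDegree_eval_le`, `Negative.polylog_pow_lt_linear`). -/
theorem orbitCompression_false_without_VP :
    ¬ (∀ f : (n : ℕ) → MvPolynomial (Fin n × Fin n) ℂ,
      (∀ (n : ℕ) (σ τ : Equiv.Perm (Fin n)),
        MvPolynomial.rename (fun p : Fin n × Fin n => (σ p.1, τ p.2)) (f n) = f n) →
      (∃ c : ℕ, ∀ n : ℕ, ∃ (G : Type) (_ : Fintype G)
        (C : LabelledArithCircuit ℂ (Fin n × Fin n) Unit G),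
        C.IsSymmetric (Equiv.Perm (Fin n)) ∧ C.eval (C.output ()) = f n ∧
          C.orbitSize (Equiv.Perm (Fin n)) ≤ 2 ^ ((Nat.log 2 n + c) ^ c)) →
      ∃ c : ℕ, ∀ n : ℕ, ∃ (G : Type) (_ : Fintype G)
        (C : LabelledArithCircuit ℂ (Fin n × Fin n) Unit G),
        C.IsSymmetric (Equiv.Perm (Fin n)) ∧ C.eval (C.output ()) = f n ∧
          Fintype.card G ≤ 2 ^ ((Nat.log 2 n + c) ^ c)) := by
  intro h
  -- the witness family `(Σ_ij x_ij)^(2^(2^n))`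
  set f : (n : ℕ) → MvPolynomial (Fin n × Fin n) ℂ :=
    fun n => (∑ p : Fin n × Fin n, X p) ^ (2 ^ (2 ^ n)) with hf
  -- matrix symmetry
  have hsymm : ∀ (n : ℕ) (σ τ : Equiv.Perm (Fin n)),
      MvPolynomial.rename (fun p : Fin n × Fin n => (σ p.1, τ p.2)) (f n) = f n := by
    intro n σ τ
    simp only [hf, map_pow, map_sum, rename_X]
    congr 1
    exact Equiv.sum_comp (Equiv.prodCongr σ τ)
      (fun p : Fin n × Fin n => (X p : MvPolynomial _ ℂ))
  -- square-symmetric circuits of orbit size `≤ max n² 1 ≤ 2^((log₂ n + 2)^2)`: the power chains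
  have horb : ∃ c : ℕ, ∀ n : ℕ, ∃ (G : Type) (_ : Fintype G)
      (C : LabelledArithCircuit ℂ (Fin n × Fin n) Unit G),
      C.IsSymmetric (Equiv.Perm (Fin n)) ∧ C.eval (C.output ()) = f n ∧
        C.orbitSize (Equiv.Perm (Fin n)) ≤ 2 ^ ((Nat.log 2 n + c) ^ c) := by
    refine ⟨2, fun n => ?_⟩
    obtain ⟨G, inst, C, hCs, hCe, hCo, -⟩ :=
      LabelledArithCircuit.exists_symmetric_powerChain ℂ (Equiv.Perm (Fin n)) (Fin n × Fin n)
        (2 ^ n)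
    refine ⟨G, inst, C, hCs, hCe, hCo.trans ?_⟩
    have hn : n < 2 ^ (Nat.log 2 n + 1) := Nat.lt_pow_succ_log_self one_lt_two n
    have h1 : n * n < 2 ^ (Nat.log 2 n + 1) * 2 ^ (Nat.log 2 n + 1) := Nat.mul_lt_mul'' hn hn
    have h2 : 2 ^ (Nat.log 2 n + 1) * 2 ^ (Nat.log 2 n + 1) ≤ 2 ^ ((Nat.log 2 n + 2) ^ 2) := by
      rw [← pow_add]
      exact Nat.pow_le_pow_right two_pos (by nlinarith)
    simp only [Fintype.card_prod, Fintype.card_fin]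
    exact max_le (by omega) Nat.one_le_two_pow
  obtain ⟨c, hc⟩ := h f hsymm horb
  -- the degree of the witness
  have hdeg : ∀ n : ℕ, 1 ≤ n → (f n).totalDegree = 2 ^ (2 ^ n) := by
    intro n hn
    have hhom : (f n).IsHomogeneous (2 ^ (2 ^ n)) := by
      have h1 : (∑ p : Fin n × Fin n, (X p : MvPolynomial (Fin n × Fin n) ℂ)).IsHomogeneous 1 :=
        IsHomogeneous.sum _ _ _ fun p _ => isHomogeneous_X ℂ p
      simpa [hf] using h1.pow (2 ^ (2 ^ n))
    refine hhom.totalDegree fun h0 => ?_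
    have h1 := congrArg (MvPolynomial.eval fun _ : Fin n × Fin n => (1 : ℂ)) h0
    simp only [hf, map_pow, map_sum, MvPolynomial.eval_X, Finset.sum_const, Finset.card_univ,
      Fintype.card_prod, Fintype.card_fin, nsmul_eq_mul, mul_one, map_zero, pow_eq_zero_iff',
      Nat.cast_eq_zero, mul_eq_zero, or_self] at h1
    omega
  -- a large `n`: `2 (log₂ n + c)^c < n`, `1 ≤ n`
  obtain ⟨n₀, hn₀⟩ := MonotoneRestorationQP.Negative.polylog_pow_lt_linear c
    (δ := 1 / 2) (by norm_num)
  obtain ⟨n, hn₀n, h1n⟩ : ∃ n : ℕ, n₀ ≤ n ∧ 1 ≤ n := ⟨max n₀ 1, le_max_left _ _, le_max_right _ _⟩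
  obtain ⟨G, inst, C, -, heval, hcard⟩ := hc n
  set E : ℕ := (Nat.log 2 n + c) ^ c with hE
  have hEn : 2 * E < n := by
    have hreal := hn₀ n hn₀n
    have : ((2 * E : ℕ) : ℝ) < (n : ℝ) := by push_cast [hE]; linarith
    exact_mod_cast this
  have hdegle := MonotoneRestorationQP.Negative.totalDegree_eval_le C (C.output ())
  rw [heval, hdeg n h1n] at hdegle
  have h1 : Fintype.card G ^ Fintype.card G ≤ (2 ^ E) ^ (2 ^ E) :=
    (Nat.pow_le_pow_left hcard _).trans (Nat.pow_le_pow_right Nat.one_le_two_pow hcard)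
  have h2 : (2 ^ E) ^ (2 ^ E) < 2 ^ (2 ^ n) := by
    rw [← pow_mul]
    refine Nat.pow_lt_pow_right one_lt_two ?_
    calc E * 2 ^ E < 2 ^ E * 2 ^ E :=
          Nat.mul_lt_mul_of_pos_right Nat.lt_two_pow_self (by positivity)
      _ = 2 ^ (E + E) := (pow_add _ _ _).symm
      _ ≤ 2 ^ n := Nat.pow_le_pow_right two_pos (by omega)
  exact absurd (hdegle.trans h1) (not_le.mpr h2)

end Summit.ValiantsHypothesis.ValiantsHypothesis.Theorems

end
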